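import Literature.Algebra.EuclideanDomain.LengthEuclideanRings
import Literature.Algebra.EuclideanDomain.TransfiniteSmallestAlgorithm
import Mathlib.RingTheory.Artinian.Module
import HarnessLib

/-!
# `ℓ(x) ≤ φ(x)` for every Euclidean function, and `ℓ(π₁ ⋯ π_n) = n` in a principal ideal domain
# (Clark 2015, Prop. 29 and Prop. 30)

Topic `Literature/Algebra/EuclideanDomain`, namespace `Literature.Algebra.EuclideanDomain`.  THEOREMS ONLY (no `def`, no
instance, no named fact), all proved; Clark's `ℓ(x) = len(R/(x))` is Mathlib's `Module.length R (R ⧸ Ideal.span {x}) : ℕ∞` as in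
`LengthEuclideanRings.lean` (whose `TODO(general form)` — Prop. 29, Prop. 30 (b) for a general PID and (c) — this file closes),
Euclidean functions are in Clark's / Motzkin's form `∀ a b, b ≠ 0 → ∃ q s, a = b * q + s ∧ (s = 0 ∨ φ s < φ b)` with values in
`ℕ`, and the bottom Euclidean function is Samuel's smallest algorithm `θ = samuelRank` of `TransfiniteSmallestAlgorithm.lean`
(stages `samuelSet R α = A_α`; Clark's `φ_R = θ − 1` off `0`).

## Source (read at the page)

P. L. Clark, *A note on Euclidean order types*, Order **32** (2015) [Clark2015EuclideanOrderTypes] (materialised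
`paper:arxiv-1208.0977`, p0007), VERBATIM.  «To ease notation, for `x ∈ R` we put `ℓ(x) = λ_R((x))` [`= len(R/(x))`].
**Proposition 29.** Let `φ` be a Euclidean function on `R`. For all `x ∈ R`, `ℓ(x) ≤ φ(x)`.  Proof. Since `R` admits a
Euclidean function, it is a principal ring, and thus `𝓘^∨(R) = R•/R×`. We may assume that `φ = φ_R` is the bottom Euclidean
function on `R`. Then both `ℓ` and `φ` induce well-defined isotone functions on `R•/R×`. But by definition `ℓ = λ_R` is the
least isotone function on `𝓘^∨(R)`, so `ℓ(x) ≤ φ_R(x)` for all `x ∈ R`.»  «If `R` is a PID and `x ∈ R•`, then the ring `R/(x)`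
is an Artinian ring and thus its length, which is equal to `ℓ(x)`, is finite. In particular, for all `x ∈ R•` `ℓ(x) < ω` and
`ℓ(0) = ω`. … **Proposition 30.** Let `R` be a PID which is not a field, and let `x ∈ R`. a) If `x ∈ R×`, then `ℓ(x) = 0`.
b) If `x ∈ R• ∖ R×`, we may write `x = π₁ ⋯ π_n` for not necessarily distinct prime elements `π₁, …, π_n`, and then `ℓ(x) = n`.
c) We have `ℓ(0) = len(R) = ω`.»  (Prop. 12, p0005: the bottom Euclidean function `φ_R` is isotone — «whenever `x` strictly
divides `y`, `φ(x) < φ(y)`»; in the tree: `samuelRank_le_samuelRank_mul`, `samuelRank_mul_eq_iff`.)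

## What is formalised

* §1 **Prop. 30 (b), (c) for a principal ideal domain**: `length_quotient_span_mul_eq_add_one` (`ℓ(πy) = ℓ(y) + 1` for
  `(π)` maximal, `y ≠ 0`, in a domain — additivity of length on `0 → R/(π) → R/(πy) → R/(y) → 0`),
  **`length_quotient_span_unit_mul_multiset_prod`** (`ℓ(u·π₁⋯π_n) = n`), `length_quotient_span_eq_card_factors` (`ℓ(x)` is the
  number of prime factors of `x ≠ 0`), `length_quotient_span_lt_top` («`ℓ(x) < ω`»), **`length_self_eq_top_of_not_isField`**
  ((c): «`ℓ(0) = len(R) = ω`» — for a non-field domain `len(R)` is infinite; Mathlib's `ℕ∞`-valued length reads `⊤`).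
* §2 **Prop. 29**: `length_quotient_span_lt_of_mem_samuelSet` (`x ∈ A_n`, `x ≠ 0` ⟹ `ℓ(x) < n`, i.e. `ℓ(x) ≤ θ(x) − 1 = φ_R(x)`,
  by induction on `n` in a principal ideal ring: every ideal strictly above `(x)` is `(y)` with `θ(y) < θ(x)`),
  `length_quotient_span_lt_samuelRank`, and **`length_quotient_span_le_of_euclideanFunction`** («for all `x ∈ R`, `ℓ(x) ≤ φ(x)`»,
  every `ℕ`-valued Euclidean function `φ`, `x ≠ 0`).
-- TODO(general form): Prop. 29 for transfinitely valued Euclidean functions (`ℓ` as an ordinal-valued length, beyond `ℕ∞`).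

## Mathlib / tree search

Mathlib: `Module.length_eq_add_of_exact`, `Module.length_quotient` (`= Order.coheight`), `Order.coheight_eq_iSup_gt_coheight`,
`Submodule.liftQ`, `Submodule.mapQ`, `Submodule.ker_liftQ_eq_bot`, `UniqueFactorizationMonoid.factors_prod`,
`UniqueFactorizationMonoid.prime_of_factor`, `IsArtinianRing.isField_of_isDomain`, `isFiniteLength_iff_isNoetherian_isArtinian`,
`ENat.lt_add_one_iff`, `Order.add_one_le_of_lt`.  Tree: `length_quotient_span_eq_zero_iff`, `length_quotient_eq_one_of_isMaximal`
(`LengthEuclideanRings.lean`); `samuelSet_zero`, `samuelSet_natCast`, `samuelRank_le_of_mem`, `mem_samuelSet_of_mul_mem`,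
`samuelRank_le_samuelRank_mul`, `samuelRank_mul_eq_iff`, `mem_samuelSet_iff_samuelRank_le`, `mem_samuelSet_samuelRank`
(`TransfiniteSmallestAlgorithm.lean`); `le_of_mem_motzkinSet` (`MotzkinConstruction.lean`); `isPrincipalIdealRing_of_euclideanFunction`
(`UniversalSideDivisors.lean`).
-/

namespace Literature.Algebra.EuclideanDomain

open Ordinal

universe u

variable {R : Type u} [CommRing R]

/-! ## §1 Prop. 30 (b), (c): `ℓ(π₁ ⋯ π_n) = n`, `ℓ(0) = ∞` in a principal ideal domain -/

section PID

/-- **`ℓ(πy) = ℓ(y) + 1`** for `y ≠ 0` and `(π)` a maximal ideal of a domain: length is additive (Prop. 6.9 of Atiyah–Macdonald)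
on the exact sequence `0 → R/(π) → R/(πy) → R/(y) → 0` of `R`-modules, the first map being multiplication by `y` (injective as
`R` is a domain), and `ℓ(π) = 1`. [cite: Clark2015EuclideanOrderTypes, Prop. 30 (b)] -/
theorem length_quotient_span_mul_eq_add_one [IsDomain R] {p y : R} (hp : (Ideal.span {p}).IsMaximal) (hy : y ≠ 0) :
    Module.length R (R ⧸ Ideal.span {p * y}) = Module.length R (R ⧸ Ideal.span {y}) + 1 := by
  set I : Ideal R := Ideal.span {p * y} with hI
  set J : Ideal R := Ideal.span {y} with hJ
  set K : Ideal R := Ideal.span {p} with hK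
  have hIJ : I ≤ J := Ideal.span_singleton_le_span_singleton.2 (dvd_mul_left y p)
  -- multiplication by `y`: `R/(π) → R/(πy)`
  let m : R →ₗ[R] R ⧸ I := I.mkQ.comp (LinearMap.mulLeft R y)
  have hm : ∀ r : R, m r = Submodule.Quotient.mk (y * r) := fun r ↦ rfl
  have hKm : K ≤ LinearMap.ker m := by
    intro r hr
    obtain ⟨a, rfl⟩ := Ideal.mem_span_singleton'.1 hr
    rw [LinearMap.mem_ker, hm, Submodule.Quotient.mk_eq_zero]
    exact Ideal.mem_span_singleton'.2 ⟨a, by ring⟩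
  have hmK : LinearMap.ker m ≤ K := by
    intro r hr
    rw [LinearMap.mem_ker, hm, Submodule.Quotient.mk_eq_zero] at hr
    obtain ⟨b, hb⟩ := Ideal.mem_span_singleton'.1 hr
    have : r = b * p := mul_left_cancel₀ hy (by rw [← hb]; ring)
    exact Ideal.mem_span_singleton'.2 ⟨b, this.symm⟩
  let f : (R ⧸ K) →ₗ[R] R ⧸ I := K.liftQ m hKm
  have hf : Function.Injective f := by
    rw [← LinearMap.ker_eq_bot]
    exact Submodule.ker_liftQ_eq_bot K m hKm hmK
  -- the projection `R/(πy) → R/(y)`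
  let g : (R ⧸ I) →ₗ[R] R ⧸ J := Submodule.mapQ I J LinearMap.id (by simpa using hIJ)
  have hg : Function.Surjective g := by
    intro z
    obtain ⟨r, rfl⟩ := Submodule.Quotient.mk_surjective J z
    exact ⟨Submodule.Quotient.mk r, rfl⟩
  have hfg : Function.Exact f g := by
    intro z
    obtain ⟨r, rfl⟩ := Submodule.Quotient.mk_surjective I z
    rw [Submodule.mapQ_apply, LinearMap.id_apply, Submodule.Quotient.mk_eq_zero]
    constructor
    · intro hr
      obtain ⟨a, rfl⟩ := Ideal.mem_span_singleton'.1 hr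
      refine ⟨Submodule.Quotient.mk a, ?_⟩
      show K.liftQ m hKm (Submodule.Quotient.mk a) = _
      rw [Submodule.liftQ_apply, hm, mul_comm]
    · rintro ⟨w, hw⟩
      obtain ⟨a, rfl⟩ := Submodule.Quotient.mk_surjective K w
      have hw' : (Submodule.Quotient.mk (y * a) : R ⧸ I) = Submodule.Quotient.mk r := hw
      rw [Submodule.Quotient.eq] at hw'
      have hmem : y * a - r ∈ J := hIJ hw'
      have : r = y * a - (y * a - r) := by ring
      rw [this]
      exact J.sub_mem (Ideal.mem_span_singleton'.2 ⟨a, mul_comm a y⟩) hmem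
  rw [Module.length_eq_add_of_exact f g hf hg hfg, length_quotient_eq_one_of_isMaximal hp, add_comm]

/-- Multiplying by a unit does not change `ℓ`: `ℓ(ux) = ℓ(x)` (`(ux) = (x)`). [cite: Clark2015EuclideanOrderTypes, Prop. 30 (a)] -/
theorem length_quotient_span_unit_mul {u x : R} (hu : IsUnit u) :
    Module.length R (R ⧸ Ideal.span {u * x}) = Module.length R (R ⧸ Ideal.span {x}) := by
  rw [Ideal.span_singleton_mul_left_unit hu]

/-- **Prop. 30 (b) «If `x ∈ R• ∖ R×`, we may write `x = π₁ ⋯ π_n` for not necessarily distinct prime elements `π₁, …, π_n`, and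
then `ℓ(x) = n`»** — for a principal ideal domain, with a unit `u` in front: `ℓ(u·π₁⋯π_n) = n`.
[cite: Clark2015EuclideanOrderTypes, Prop. 30 (b)] -/
theorem length_quotient_span_unit_mul_multiset_prod [IsDomain R] [IsPrincipalIdealRing R] (s : Multiset R)
    (hs : ∀ p ∈ s, Prime p) {u : R} (hu : IsUnit u) :
    Module.length R (R ⧸ Ideal.span {u * s.prod}) = Multiset.card s := by
  induction s using Multiset.induction_on with
  | empty =>
    rw [Multiset.prod_zero, mul_one, Multiset.card_zero, Nat.cast_zero]
    exact length_quotient_span_eq_zero_iff.2 hu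
  | cons p t ih =>
    have hp : Prime p := hs p (Multiset.mem_cons_self p t)
    have ht : ∀ q ∈ t, Prime q := fun q hq ↦ hs q (Multiset.mem_cons_of_mem hq)
    have ht0 : u * t.prod ≠ 0 :=
      mul_ne_zero hu.ne_zero (Multiset.prod_ne_zero fun h ↦ (ht 0 h).ne_zero rfl)
    rw [Multiset.prod_cons, Multiset.card_cons, show u * (p * t.prod) = p * (u * t.prod) by ring,
      length_quotient_span_mul_eq_add_one (PrincipalIdealRing.isMaximal_of_irreducible hp.irreducible) ht0, ih ht,
      Nat.cast_succ]

/-- Prop. 30 (b) with the prime factorisation chosen by Mathlib: **`ℓ(x)` is the number of prime factors of `x ≠ 0`**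
(`UniqueFactorizationMonoid.factors`). [cite: Clark2015EuclideanOrderTypes, Prop. 30 (b)] -/
theorem length_quotient_span_eq_card_factors [IsDomain R] [IsPrincipalIdealRing R] {x : R} (hx : x ≠ 0) :
    Module.length R (R ⧸ Ideal.span {x}) = Multiset.card (UniqueFactorizationMonoid.factors x) := by
  obtain ⟨u, hu⟩ := UniqueFactorizationMonoid.factors_prod hx
  have h := length_quotient_span_unit_mul_multiset_prod (UniqueFactorizationMonoid.factors x)
    (fun p hp ↦ UniqueFactorizationMonoid.prime_of_factor p hp) u.isUnit
  rwa [mul_comm, hu] at h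

/-- «for all `x ∈ R•`, `ℓ(x) < ω`»: `ℓ(x)` is finite for `x ≠ 0` in a principal ideal domain.
[cite: Clark2015EuclideanOrderTypes, §3.1 (before Prop. 30)] -/
theorem length_quotient_span_lt_top [IsDomain R] [IsPrincipalIdealRing R] {x : R} (hx : x ≠ 0) :
    Module.length R (R ⧸ Ideal.span {x}) < ⊤ := by
  rw [length_quotient_span_eq_card_factors hx]
  exact ENat.coe_lt_top _

/-- **Prop. 30 (c) «`ℓ(0) = len(R) = ω`»**: for a domain `R` which is not a field the length `len(R) = ℓ(0)` is infinite
(`R` is not Artinian: an Artinian domain is a field); with Mathlib's `ℕ∞`-valued length, `len(R) = ⊤`.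
[cite: Clark2015EuclideanOrderTypes, Prop. 30 (c)] -/
theorem length_self_eq_top_of_not_isField [IsDomain R] (hR : ¬ IsField R) : Module.length R R = ⊤ := by
  by_contra h
  have hfin : IsFiniteLength R R := Module.length_ne_top_iff.1 h
  haveI : IsArtinianRing R := (isFiniteLength_iff_isNoetherian_isArtinian.1 hfin).2
  exact hR (IsArtinianRing.isField_of_isDomain R)

/-- Prop. 30 (c) in the form `ℓ(0) = len(R/(0)) = ⊤` for a non-field domain. [cite: Clark2015EuclideanOrderTypes, Prop. 30 (c)] -/
theorem length_quotient_span_zero_eq_top_of_not_isField [IsDomain R] (hR : ¬ IsField R) :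
    Module.length R (R ⧸ Ideal.span {(0 : R)}) = ⊤ := by
  rw [(Submodule.quotEquivOfEqBot (Ideal.span {(0 : R)}) (by rw [Ideal.span_singleton_eq_bot])).length_eq]
  exact length_self_eq_top_of_not_isField hR

end PID

/-! ## §2 Prop. 29: `ℓ(x) ≤ φ(x)` -/

section PropTwentyNine

/-- **`x ∈ A_n`, `x ≠ 0` ⟹ `ℓ(x) < n`**, i.e. `ℓ(x) ≤ θ(x) − 1 = φ_R(x)` (Prop. 29 for the bottom Euclidean function, finite
values), in a principal ideal ring: every ideal strictly above `(x)` is `(y)` with `x = yc` and `(x) ≠ (y)`, so `θ(y) < θ(x)`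
(Samuel's Prop. 4 (b): `θ(yc) = θ(y)` iff `(yc) = (y)`) and by induction `ℓ(y) + 1 ≤ θ(y) ≤ n − 1`; `ℓ(x) = sup (ℓ(y) + 1)`.
[cite: Clark2015EuclideanOrderTypes, Prop. 29 (proof: «`ℓ = λ_R` is the least isotone function»)] -/
theorem length_quotient_span_lt_of_mem_samuelSet [IsPrincipalIdealRing R] :
    ∀ (n : ℕ) {x : R}, x ≠ 0 → x ∈ samuelSet R n → Module.length R (R ⧸ Ideal.span {x}) < n := by
  intro n
  induction n using Nat.strong_induction_on with
  | _ n ih =>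
    intro x hx0 hx
    cases n with
    | zero =>
      rw [Nat.cast_zero, samuelSet_zero] at hx
      exact absurd hx hx0
    | succ k =>
      rw [Module.length_quotient]
      -- `coheight (x) ≤ k`: bound every ideal strictly above `(x)`
      suffices h : Order.coheight (Ideal.span {x} : Ideal R) ≤ k from
        h.trans_lt (by exact_mod_cast Nat.lt_succ_self k)
      rw [Order.coheight_eq_iSup_gt_coheight]
      refine iSup₂_le fun J hJ ↦ ?_
      obtain ⟨y, hy⟩ := (IsPrincipalIdealRing.principal J).principal
      have hy' : J = Ideal.span {y} := hy
      rw [hy'] at hJ ⊢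
      obtain ⟨c, rfl⟩ : y ∣ x := Ideal.span_singleton_le_span_singleton.1 hJ.le
      have hy0 : y ≠ 0 := left_ne_zero_of_mul hx0
      have hxα : ∃ α : Ordinal.{u}, y * c ∈ samuelSet R α := ⟨_, hx⟩
      have hθx : samuelRank (y * c) ≤ ((k + 1 : ℕ) : Ordinal.{u}) := samuelRank_le_of_mem hx
      have hne : samuelRank (y * c) ≠ samuelRank y := fun h ↦ hJ.ne ((samuelRank_mul_eq_iff hxα hx0).1 h)
      have hlt : samuelRank y < samuelRank (y * c) := lt_of_le_of_ne (samuelRank_le_samuelRank_mul hxα hx0) hne.symm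
      have hyk : samuelRank y ≤ ((k : ℕ) : Ordinal.{u}) := by
        have h : samuelRank y < ((k : ℕ) : Ordinal.{u}) + 1 := by
          have := hlt.trans_le hθx
          rwa [Nat.cast_succ] at this
        exact Order.lt_add_one_iff.1 h
      have hymem : y ∈ samuelSet R (k : ℕ) :=
        (mem_samuelSet_iff_samuelRank_le ⟨_, mem_samuelSet_of_mul_mem hx hx0⟩).2 hyk
      have ihy := ih k (Nat.lt_succ_self k) hy0 hymem
      rw [Module.length_quotient] at ihy
      exact Order.add_one_le_of_lt ihy

/-- Prop. 29 for the bottom function: **`ℓ(x) < θ(x)`** (`ℓ(x) ≤ φ_R(x) = θ(x) − 1`) for `x ≠ 0` of finite `θ(x) = n` lying in some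
stage of the construction, principal ideal ring. [cite: Clark2015EuclideanOrderTypes, Prop. 29] -/
theorem length_quotient_span_lt_samuelRank [IsPrincipalIdealRing R] {x : R} (hxs : ∃ α : Ordinal.{u}, x ∈ samuelSet R α)
    (hx0 : x ≠ 0) {n : ℕ} (hθ : samuelRank x = n) : Module.length R (R ⧸ Ideal.span {x}) < n :=
  length_quotient_span_lt_of_mem_samuelSet n hx0 (hθ ▸ mem_samuelSet_samuelRank hxs)

/-- **Prop. 29 «Let `φ` be a Euclidean function on `R`. For all `x ∈ R`, `ℓ(x) ≤ φ(x)`»** — for every `ℕ`-valued Euclidean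
function in Clark's form (`a = bq + s`, `s = 0` or `φ(s) < φ(b)`) and `x ≠ 0`: `x ∈ A_{φ(x)+1}` (Motzkin: `φ ≥ k` on `P₀^{(k)}`,
`A_k = R ∖ P₀^{(k)}`), so `ℓ(x) < φ(x) + 1`.  (`R` is a principal ideal ring as it carries a Euclidean function.)
[cite: Clark2015EuclideanOrderTypes, Prop. 29] -/
theorem length_quotient_span_le_of_euclideanFunction {φ : R → ℕ}
    (hφ : ∀ a b : R, b ≠ 0 → ∃ q s : R, a = b * q + s ∧ (s = 0 ∨ φ s < φ b)) {x : R} (hx : x ≠ 0) :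
    Module.length R (R ⧸ Ideal.span {x}) ≤ φ x := by
  haveI := isPrincipalIdealRing_of_euclideanFunction φ hφ
  have hmem : x ∈ samuelSet R ((φ x + 1 : ℕ) : Ordinal.{u}) := by
    rw [samuelSet_natCast]
    intro h
    have := le_of_mem_motzkinSet hφ _ _ h
    omega
  have hlt := length_quotient_span_lt_of_mem_samuelSet (φ x + 1) hx hmem
  rw [Nat.cast_succ] at hlt
  exact (ENat.lt_add_one_iff (ENat.coe_ne_top _)).1 hlt

/-- Prop. 29 for Samuel's smallest algorithm read through Motzkin's criterion: if the finite stages exhaust `R` then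
`ℓ(x) + 1 ≤ θ(x)` for all `x ≠ 0` (`θ = 1 +` Motzkin's minimal norm). [cite: Clark2015EuclideanOrderTypes, Prop. 29 and
Prop. 12 (the bottom Euclidean function)] -/
theorem length_quotient_span_add_one_le_samuelRank [IsPrincipalIdealRing R] {x : R} {n : ℕ} (hx0 : x ≠ 0)
    (hx : x ∈ samuelSet R n) : Module.length R (R ⧸ Ideal.span {x}) + 1 ≤ n :=
  Order.add_one_le_of_lt (length_quotient_span_lt_of_mem_samuelSet n hx0 hx)

/-- Example (`ℤ`, where `θ(n)` is the number of binary digits of `|n|` and `ℓ(n)` the number of prime factors): `ℓ(n) + 1 ≤ θ(n)`,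
e.g. `ℓ(12) = 3 < θ(12) = 4`. [cite: Clark2015EuclideanOrderTypes, Prop. 29 and Example 3.1 (a)] -/
theorem Int.length_quotient_span_lt_size {n : ℤ} (hn : n ≠ 0) :
    Module.length ℤ (ℤ ⧸ Ideal.span {n}) < n.natAbs.size := by
  obtain ⟨k, hk⟩ := Set.mem_iUnion.1 (Set.eq_univ_iff_forall.1 Int.iUnion_samuelSet_natCast n)
  exact length_quotient_span_lt_samuelRank ⟨_, hk⟩ hn (Int.samuelRank_eq n)

end PropTwentyNine

end Literature.Algebra.EuclideanDomain
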